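import Summits.ValiantsHypothesis.ValiantsHypothesis.Theorems.NewtonUnitEquationsTwoProductsConfinedTameLawSlice
import HarnessLib

/-!
# R11 Stage 2 engine piece (prepared tool): FINITE SHIFT RANK OF EXPONENTIAL POLYNOMIALS WITH POLYNOMIAL COEFFICIENTS
`F(ν) = Σ_j (Σ_{q ≤ D} a j q · |ν|^q) · c_j^ν − Σ_j (Σ_{q ≤ D} b j q · |ν|^q) · d_j^ν` has the shift decomposition
`F(β + w) = Σ_{t : Fin m × Bool × Fin (D+1)} col t β · ch t w` — shift rank `2m(D+1)` — which is exactly the `hF` hypothesis of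
`ShiftRank.pencilCount`.  This is the card's «ONE typed engine piece `ExpPolyPencilCount`» for R11 Stage 2 (`freiman-ray-split`, val-idea-32:
rays + free letters), reduced to the tree's pencil count; the binomial expansion `(|β|+|w|)^q = Σ_i C(q,i) |β|^i |w|^{q−i}` plays the role of
R10's `ascFactorial_add_eq`.  Tool only; nothing here closes 5906; VP ≠ VNP is NOT proved.
-/

noncomputable section
set_option linter.dupNamespace false
set_option linter.unusedSectionVars false

namespace Summit.ValiantsHypothesis.ValiantsHypothesis.Theorems.NewtonUnitEquations.TwoProducts.PermutationType
namespace R11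
open scoped BigOperators

variable {σ : Type*} [Fintype σ] [DecidableEq σ] {m : ℕ}

/-- An exponential polynomial with polynomial coefficients of degree `≤ D` in the total mass. [val-idea-32, Stage 2] -/
def expPoly (D : ℕ) (a b : Fin m → Fin (D + 1) → ℂ) (c d : Fin m → σ → ℂ) (ν : σ → ℕ) : ℂ :=
  ∑ j, ((∑ q : Fin (D + 1), a j q * ((R10.mass ν : ℂ)) ^ (q : ℕ)) * R10.momF (c j) ν -
    (∑ q : Fin (D + 1), b j q * ((R10.mass ν : ℂ)) ^ (q : ℕ)) * R10.momF (d j) ν)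

/-- Column functions (depend on the shift `β`): `c_j^β |β|^i`, `d_j^β |β|^i`. [folklore] -/
def colE (c d : Fin m → σ → ℂ) (D : ℕ) (β : σ → ℕ) : R10.SIdx m D → ℂ
  | (j, true, i) => R10.momF (c j) β * ((R10.mass β : ℂ)) ^ (i : ℕ)
  | (j, false, i) => R10.momF (d j) β * ((R10.mass β : ℂ)) ^ (i : ℕ)

/-- Character functions (depend on `w`): `c_j^w · Σ_{q ≥ i} a j q C(q,i) |w|^{q−i}` (and the `d`-side with a sign). [folklore] -/
def chE (D : ℕ) (a b : Fin m → Fin (D + 1) → ℂ) (c d : Fin m → σ → ℂ) : R10.SIdx m D → (σ → ℕ) → ℂ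
  | (j, true, i) => fun w => R10.momF (c j) w *
      ∑ q : Fin (D + 1), a j q * ((Nat.choose q i : ℕ) : ℂ) * ((R10.mass w : ℂ)) ^ ((q : ℕ) - (i : ℕ))
  | (j, false, i) => fun w => -(R10.momF (d j) w *
      ∑ q : Fin (D + 1), b j q * ((Nat.choose q i : ℕ) : ℂ) * ((R10.mass w : ℂ)) ^ ((q : ℕ) - (i : ℕ)))

/-- The binomial expansion of a power of the total mass of a sum, as a sum over `Fin (D+1)`. [folklore] -/
theorem mass_add_pow (D : ℕ) (β w : σ → ℕ) (q : Fin (D + 1)) :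
    ((R10.mass (β + w) : ℂ)) ^ (q : ℕ) =
      ∑ i : Fin (D + 1), ((Nat.choose q i : ℕ) : ℂ) * ((R10.mass β : ℂ)) ^ (i : ℕ) * ((R10.mass w : ℂ)) ^ ((q : ℕ) - (i : ℕ)) := by
  rw [R10.mass_add, Nat.cast_add, add_pow]
  -- extend the range (q+1) sum to Fin (D+1): the extra binomials vanish
  rw [Finset.sum_range, Fin.sum_univ_eq_sum_range (fun i => ((Nat.choose q i : ℕ) : ℂ) * ((R10.mass β : ℂ)) ^ i *
    ((R10.mass w : ℂ)) ^ ((q : ℕ) - i)) (D + 1)]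
  rw [Fin.sum_univ_eq_sum_range (fun i => ((R10.mass β : ℂ)) ^ i * ((R10.mass w : ℂ)) ^ ((q : ℕ) - i) * ((Nat.choose q i : ℕ) : ℂ)) (q + 1)]
  have hq : (q : ℕ) + 1 ≤ D + 1 := by have := q.2; omega
  rw [← Finset.sum_range_add_sum_Ico _ hq]
  have hz : ∑ i ∈ Finset.Ico ((q : ℕ) + 1) (D + 1), ((Nat.choose q i : ℕ) : ℂ) * ((R10.mass β : ℂ)) ^ i *
      ((R10.mass w : ℂ)) ^ ((q : ℕ) - i) = 0 :=
    Finset.sum_eq_zero fun i hi => by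
      rw [Nat.choose_eq_zero_of_lt (by have := (Finset.mem_Ico.mp hi).1; omega)]; simp
  rw [hz, add_zero]
  exact Finset.sum_congr rfl fun i _ => by ring

/-- **Finite shift rank of exponential polynomials with polynomial coefficients** (`ExpPolyPencilCount`'s input): rank `2m(D+1)`. [folklore] -/
theorem expPoly_shift (D : ℕ) (a b : Fin m → Fin (D + 1) → ℂ) (c d : Fin m → σ → ℂ) (β w : σ → ℕ) :
    expPoly D a b c d (β + w) = ∑ t : R10.SIdx m D, colE c d D β t * chE D a b c d t w := by
  classical
  -- canonical triple sums
  have lhs : expPoly D a b c d (β + w) = ∑ j, ∑ i : Fin (D + 1),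
      (R10.momF (c j) β * ((R10.mass β : ℂ)) ^ (i : ℕ) * (R10.momF (c j) w *
        ∑ q : Fin (D + 1), a j q * ((Nat.choose q i : ℕ) : ℂ) * ((R10.mass w : ℂ)) ^ ((q : ℕ) - (i : ℕ))) -
       R10.momF (d j) β * ((R10.mass β : ℂ)) ^ (i : ℕ) * (R10.momF (d j) w *
        ∑ q : Fin (D + 1), b j q * ((Nat.choose q i : ℕ) : ℂ) * ((R10.mass w : ℂ)) ^ ((q : ℕ) - (i : ℕ)))) := by
    unfold expPoly
    refine Finset.sum_congr rfl fun j _ => ?_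
    simp only [mass_add_pow, R10.momF_add]
    -- both sides: Σ_i (...)_i ; expand Σ_q a_q Σ_i (...) into Σ_i Σ_q
    have e1 : ∀ (f : Fin (D + 1) → ℂ) (X Y : ℂ),
        (∑ q : Fin (D + 1), f q * ∑ i : Fin (D + 1), ((Nat.choose q i : ℕ) : ℂ) * ((R10.mass β : ℂ)) ^ (i : ℕ) *
          ((R10.mass w : ℂ)) ^ ((q : ℕ) - (i : ℕ))) * (X * Y) =
        ∑ i : Fin (D + 1), X * ((R10.mass β : ℂ)) ^ (i : ℕ) * (Y * ∑ q : Fin (D + 1), f q * ((Nat.choose q i : ℕ) : ℂ) *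
          ((R10.mass w : ℂ)) ^ ((q : ℕ) - (i : ℕ))) := by
      intro f X Y
      simp only [Finset.mul_sum, Finset.sum_mul]
      rw [Finset.sum_comm]
      exact Finset.sum_congr rfl fun i _ => Finset.sum_congr rfl fun q _ => by ring
    rw [e1, e1, ← Finset.sum_sub_distrib]
  have rhs : ∑ t : R10.SIdx m D, colE c d D β t * chE D a b c d t w = ∑ j, ∑ i : Fin (D + 1),
      (R10.momF (c j) β * ((R10.mass β : ℂ)) ^ (i : ℕ) * (R10.momF (c j) w *
        ∑ q : Fin (D + 1), a j q * ((Nat.choose q i : ℕ) : ℂ) * ((R10.mass w : ℂ)) ^ ((q : ℕ) - (i : ℕ))) -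
       R10.momF (d j) β * ((R10.mass β : ℂ)) ^ (i : ℕ) * (R10.momF (d j) w *
        ∑ q : Fin (D + 1), b j q * ((Nat.choose q i : ℕ) : ℂ) * ((R10.mass w : ℂ)) ^ ((q : ℕ) - (i : ℕ)))) := by
    rw [Fintype.sum_prod_type]
    refine Finset.sum_congr rfl fun j _ => ?_
    rw [Fintype.sum_prod_type, Fintype.sum_bool, ← Finset.sum_add_distrib]
    refine Finset.sum_congr rfl fun i _ => ?_
    simp only [colE, chE, mul_neg, sub_eq_add_neg]
  rw [lhs, rhs]

end R11
end Summit.ValiantsHypothesis.ValiantsHypothesis.Theorems.NewtonUnitEquations.TwoProducts.PermutationType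

end
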